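import Literature.AlgebraicGeometry.Frobenioids.PrimaryStepsTransport
import HarnessLib

/-!
# Frobenioids I, Theorem 4.2 (ii)/(iii): transport of `≤` between divisors of pre-steps along an
# equivalence ("compatible with `≤`", p. 81) — the categories `{A(C^coa-pre)}`, `{(C^coa-pre)_A}`

Mochizuki, *The geometry of Frobenioids I: the general theory*, Kyushu J. Math. **62** (2008)
293–400, §4, Theorem 4.2 (ii)/(iii), kurims text pp. 77–81 [cite: MochizukiFrdI2008, Thm. 4.2 (ii) p.77]:
"the map induced by `Ψ` on pre-steps [cf. (i); Theorem 3.4, (ii)] induces equivalences of categories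
`{A₁(C₁^coa-pre)}_𝔭₁ ≅ {A₂(C₂^coa-pre)}_𝔭₂; {(C₁^coa-pre)_A₁}_𝔭₁ ≅ {(C₂^coa-pre)_A₂}_𝔭₂`, hence
equivalences of categories `Order(Φ₁(A₁)_𝔭₁) ≅ Order(Φ₂(A₂)_𝔭₂)` …" and (iii), proof p. 81: the
resulting "bijections of sets … are compatible both with `≤` and with multiplication by elements of
`ℕ≥1`".

PROVED here (the "compatible with `≤`" half, for ALL pre-steps to / from `A`, no primality needed):
for Frobenioids of isotropic type and an equivalence `Ψ` with `Ψ`, `Ψ⁻¹` preserving pre-steps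
[Thm. 3.4 (ii), HYPOTHESES]: for pre-steps `ψ, χ` into `A`, `x_ψ ≤ x_χ ⟺ x_{Ψψ} ≤ x_{Ψχ}`
(`invDiv_dvd_iff_map`), hence `x_ψ = x_χ ⟺ x_{Ψψ} = x_{Ψχ}` (`invDiv_eq_iff_map`); dually for
pre-steps out of `A` and `Div` (`div_dvd_iff_map`, `div_eq_iff_map`) — via Definition 1.3 (iii)(d)
(`exists_preStep_over_iff_invDiv_dvd`, `exists_preStep_under_iff_div_dvd`) and reflection of pre-steps
along a full functor (`isPreStep_of_map`). These are the well-definedness and order-compatibility of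
the element-level bijections `Φ₁(A)_𝔭 ≅ Φ₂(Ψ A)_{e A 𝔭}` of Thm. 4.2 (iii); the compatibility with
`ℕ≥1` (via the Div-identity endomorphisms of a Div-Frobenius-trivial `A`, Prop. 1.10 (i)) and the
monoid conclusion are not in this file. Composition is diagrammatic; monoids multiplicative.
No new definitions.
-/

namespace Literature.AlgebraicGeometry.Frobenioids

open CategoryTheory Opposite

namespace PreFrobenioid

universe w v v' u u' w₂ v₂ v₂' u₂ u₂'

variable {D : Type u} [Category.{v} D] {Φ : Dᵒᵖ ⥤ CommMonCat.{w}}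
  {C : Type u'} [Category.{v'} C] {F : C ⥤ ElemFrobenioid Φ}
variable {D₂ : Type u₂} [Category.{v₂} D₂] {Φ₂ : D₂ᵒᵖ ⥤ CommMonCat.{w₂}}
  {C₂ : Type u₂'} [Category.{v₂'} C₂] {F₂ : C₂ ⥤ ElemFrobenioid Φ₂} (Ψ : C ≌ C₂)

set_option backward.isDefEq.respectTransparency false in
/-- `Ψ` reflects pre-steps if `Ψ⁻¹` preserves them (Prop. 1.7 (v): the factors of a pre-step are
pre-steps, applied to `Ψ⁻¹Ψ(φ) = u⁻¹ ∘ φ ∘ u`). [cite: MochizukiFrdI2008, Thm. 3.4 (ii) p.62] -/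
theorem isPreStep_of_map (hP : IsPreFrobenioid Φ F)
    (hpre' : ∀ ⦃X Y : C₂⦄ (φ : X ⟶ Y), IsPreStep F₂ φ → IsPreStep F (Ψ.inverse.map φ))
    {X Y : C} {φ : X ⟶ Y} (h : IsPreStep F₂ (Ψ.functor.map φ)) : IsPreStep F φ := by
  have h1 := hpre' _ h
  rw [Ψ.inv_fun_map] at h1
  exact (isPreStep_factors F hP.isTotallyEpimorphic_base
    (isPreStep_factors F hP.isTotallyEpimorphic_base h1).1).2

/-- Factorisation through a pre-step over `A` is transported by `Ψ` (both ways): for pre-steps... in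
fact for arbitrary `ψ : Y → A`, `χ : X → A`: `χ` factors through `ψ` by a pre-step iff `Ψ χ` factors
through `Ψ ψ` by a pre-step. [cite: MochizukiFrdI2008, Thm. 4.2 (ii) p.77] -/
theorem exists_preStep_over_iff_map (hP : IsPreFrobenioid Φ F)
    (hpre : ∀ ⦃X Y : C⦄ (φ : X ⟶ Y), IsPreStep F φ → IsPreStep F₂ (Ψ.functor.map φ))
    (hpre' : ∀ ⦃X Y : C₂⦄ (φ : X ⟶ Y), IsPreStep F₂ φ → IsPreStep F (Ψ.inverse.map φ))
    {X Y A : C} (χ : X ⟶ A) (ψ : Y ⟶ A) :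
    (∃ ζ : X ⟶ Y, IsPreStep F ζ ∧ ζ ≫ ψ = χ) ↔
      ∃ ζ : Ψ.functor.obj X ⟶ Ψ.functor.obj Y, IsPreStep F₂ ζ ∧ ζ ≫ Ψ.functor.map ψ = Ψ.functor.map χ := by
  constructor
  · rintro ⟨ζ, hζ, rfl⟩
    exact ⟨Ψ.functor.map ζ, hpre ζ hζ, (Ψ.functor.map_comp ζ ψ).symm⟩
  · rintro ⟨ζ, hζ, e⟩
    refine ⟨Ψ.functor.preimage ζ, isPreStep_of_map Ψ hP hpre' (by rwa [Ψ.functor.map_preimage]),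
      Ψ.functor.map_injective ?_⟩
    rw [Functor.map_comp, Ψ.functor.map_preimage, e]

/-- Factorisation through a pre-step under `A` is transported by `Ψ` (both ways).
[cite: MochizukiFrdI2008, Thm. 4.2 (ii) p.77] -/
theorem exists_preStep_under_iff_map (hP : IsPreFrobenioid Φ F)
    (hpre : ∀ ⦃X Y : C⦄ (φ : X ⟶ Y), IsPreStep F φ → IsPreStep F₂ (Ψ.functor.map φ))
    (hpre' : ∀ ⦃X Y : C₂⦄ (φ : X ⟶ Y), IsPreStep F₂ φ → IsPreStep F (Ψ.inverse.map φ))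
    {A B X : C} (φ : A ⟶ B) (χ : A ⟶ X) :
    (∃ ζ : B ⟶ X, IsPreStep F ζ ∧ φ ≫ ζ = χ) ↔
      ∃ ζ : Ψ.functor.obj B ⟶ Ψ.functor.obj X, IsPreStep F₂ ζ ∧ Ψ.functor.map φ ≫ ζ = Ψ.functor.map χ := by
  constructor
  · rintro ⟨ζ, hζ, rfl⟩
    exact ⟨Ψ.functor.map ζ, hpre ζ hζ, (Ψ.functor.map_comp φ ζ).symm⟩
  · rintro ⟨ζ, hζ, e⟩
    refine ⟨Ψ.functor.preimage ζ, isPreStep_of_map Ψ hP hpre' (by rwa [Ψ.functor.map_preimage]),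
      Ψ.functor.map_injective ?_⟩
    rw [Functor.map_comp, Ψ.functor.map_preimage, e]

/-- **Theorem 4.2 (ii)/(iii), "compatible with `≤`", slice over `A`**: for pre-steps `ψ : Y → A`,
`χ : X → A` of Frobenioids of isotropic type and `Ψ`, `Ψ⁻¹` preserving pre-steps,
`x_ψ ≤ x_χ` in `Φ₁(A)` iff `x_{Ψψ} ≤ x_{Ψχ}` in `Φ₂(Ψ A)`. [cite: MochizukiFrdI2008, Thm. 4.2 (iii) p.78] -/
theorem invDiv_dvd_iff_map (hF : IsFrobenioid F) (hF₂ : IsFrobenioid F₂)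
    (histr : IsOfIsotropicType F) (histr₂ : IsOfIsotropicType F₂)
    (hpre : ∀ ⦃X Y : C⦄ (φ : X ⟶ Y), IsPreStep F φ → IsPreStep F₂ (Ψ.functor.map φ))
    (hpre' : ∀ ⦃X Y : C₂⦄ (φ : X ⟶ Y), IsPreStep F₂ φ → IsPreStep F (Ψ.inverse.map φ))
    {X Y A : C} {χ : X ⟶ A} {ψ : Y ⟶ A} (hχ : IsPreStep F χ) (hψ : IsPreStep F ψ) :
    invDiv F ψ hψ.2 ∣ invDiv F χ hχ.2 ↔
      invDiv F₂ (Ψ.functor.map ψ) (hpre ψ hψ).2 ∣ invDiv F₂ (Ψ.functor.map χ) (hpre χ hχ).2 := by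
  rw [← exists_preStep_over_iff_invDiv_dvd hF histr hχ hψ,
    ← exists_preStep_over_iff_invDiv_dvd hF₂ histr₂ (hpre χ hχ) (hpre ψ hψ),
    exists_preStep_over_iff_map Ψ hF.isPreFrobenioid hpre hpre' χ ψ]

/-- **Theorem 4.2 (ii)/(iii), "compatible with `≤`", coslice under `A`**: for pre-steps `φ : A → B`,
`χ : A → X`, `Div φ ≤ Div χ` in `Φ₁(A)` iff `Div(Ψφ) ≤ Div(Ψχ)` in `Φ₂(Ψ A)`.
[cite: MochizukiFrdI2008, Thm. 4.2 (iii) p.78] -/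
theorem div_dvd_iff_map (hF : IsFrobenioid F) (hF₂ : IsFrobenioid F₂)
    (histr : IsOfIsotropicType F) (histr₂ : IsOfIsotropicType F₂)
    (hpre : ∀ ⦃X Y : C⦄ (φ : X ⟶ Y), IsPreStep F φ → IsPreStep F₂ (Ψ.functor.map φ))
    (hpre' : ∀ ⦃X Y : C₂⦄ (φ : X ⟶ Y), IsPreStep F₂ φ → IsPreStep F (Ψ.inverse.map φ))
    {A B X : C} {φ : A ⟶ B} {χ : A ⟶ X} (hφ : IsPreStep F φ) (hχ : IsPreStep F χ) :
    Div F φ ∣ Div F χ ↔ Div F₂ (Ψ.functor.map φ) ∣ Div F₂ (Ψ.functor.map χ) := by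
  rw [← exists_preStep_under_iff_div_dvd hF histr hφ hχ,
    ← exists_preStep_under_iff_div_dvd hF₂ histr₂ (hpre φ hφ) (hpre χ hχ),
    exists_preStep_under_iff_map Ψ hF.isPreFrobenioid hpre hpre' φ χ]

/-- Slice over `A`: `x_ψ = x_χ` iff `x_{Ψψ} = x_{Ψχ}` (mutual divisibility in a sharp integral monoid) —
the well-definedness and injectivity of `x_ψ ↦ x_{Ψψ}`. [cite: MochizukiFrdI2008, Thm. 4.2 (iii) p.78] -/
theorem invDiv_eq_iff_map (hF : IsFrobenioid F) (hF₂ : IsFrobenioid F₂)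
    (histr : IsOfIsotropicType F) (histr₂ : IsOfIsotropicType F₂)
    (hpre : ∀ ⦃X Y : C⦄ (φ : X ⟶ Y), IsPreStep F φ → IsPreStep F₂ (Ψ.functor.map φ))
    (hpre' : ∀ ⦃X Y : C₂⦄ (φ : X ⟶ Y), IsPreStep F₂ φ → IsPreStep F (Ψ.inverse.map φ))
    {X Y A : C} {χ : X ⟶ A} {ψ : Y ⟶ A} (hχ : IsPreStep F χ) (hψ : IsPreStep F ψ) :
    invDiv F ψ hψ.2 = invDiv F χ hχ.2 ↔
      invDiv F₂ (Ψ.functor.map ψ) (hpre ψ hψ).2 = invDiv F₂ (Ψ.functor.map χ) (hpre χ hχ).2 := by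
  have hM : ∀ X : D, IsSharp (Φ.obj (op X)) := fun X => (hF.isPreFrobenioid.isDivisorial X).isSharp
  have hM₂ : ∀ X : D₂, IsSharp (Φ₂.obj (op X)) := fun X => (hF₂.isPreFrobenioid.isDivisorial X).isSharp
  haveI : ∀ X : D, IsCancelMul (Φ.obj (op X)) := fun X =>
    isIntegral_iff_isCancelMul.mp (hF.isPreFrobenioid.isDivisorial X).isPreDivisorial.isIntegral
  haveI : ∀ X : D₂, IsCancelMul (Φ₂.obj (op X)) := fun X =>
    isIntegral_iff_isCancelMul.mp (hF₂.isPreFrobenioid.isDivisorial X).isPreDivisorial.isIntegral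
  constructor
  · intro h
    exact dvd_antisymm_of_isSharp (hM₂ _)
      ((invDiv_dvd_iff_map Ψ hF hF₂ histr histr₂ hpre hpre' hχ hψ).mp h.dvd)
      ((invDiv_dvd_iff_map Ψ hF hF₂ histr histr₂ hpre hpre' hψ hχ).mp h.symm.dvd)
  · intro h
    exact dvd_antisymm_of_isSharp (hM _)
      ((invDiv_dvd_iff_map Ψ hF hF₂ histr histr₂ hpre hpre' hχ hψ).mpr h.dvd)
      ((invDiv_dvd_iff_map Ψ hF hF₂ histr histr₂ hpre hpre' hψ hχ).mpr h.symm.dvd)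

/-- Coslice under `A`: `Div φ = Div χ` iff `Div(Ψφ) = Div(Ψχ)` — the well-definedness and injectivity
of `Div φ ↦ Div(Ψφ)`. [cite: MochizukiFrdI2008, Thm. 4.2 (iii) p.78] -/
theorem div_eq_iff_map (hF : IsFrobenioid F) (hF₂ : IsFrobenioid F₂)
    (histr : IsOfIsotropicType F) (histr₂ : IsOfIsotropicType F₂)
    (hpre : ∀ ⦃X Y : C⦄ (φ : X ⟶ Y), IsPreStep F φ → IsPreStep F₂ (Ψ.functor.map φ))
    (hpre' : ∀ ⦃X Y : C₂⦄ (φ : X ⟶ Y), IsPreStep F₂ φ → IsPreStep F (Ψ.inverse.map φ))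
    {A B X : C} {φ : A ⟶ B} {χ : A ⟶ X} (hφ : IsPreStep F φ) (hχ : IsPreStep F χ) :
    Div F φ = Div F χ ↔ Div F₂ (Ψ.functor.map φ) = Div F₂ (Ψ.functor.map χ) := by
  have hM : ∀ X : D, IsSharp (Φ.obj (op X)) := fun X => (hF.isPreFrobenioid.isDivisorial X).isSharp
  have hM₂ : ∀ X : D₂, IsSharp (Φ₂.obj (op X)) := fun X => (hF₂.isPreFrobenioid.isDivisorial X).isSharp
  haveI : ∀ X : D, IsCancelMul (Φ.obj (op X)) := fun X =>
    isIntegral_iff_isCancelMul.mp (hF.isPreFrobenioid.isDivisorial X).isPreDivisorial.isIntegral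
  haveI : ∀ X : D₂, IsCancelMul (Φ₂.obj (op X)) := fun X =>
    isIntegral_iff_isCancelMul.mp (hF₂.isPreFrobenioid.isDivisorial X).isPreDivisorial.isIntegral
  constructor
  · intro h
    exact dvd_antisymm_of_isSharp (hM₂ _)
      ((div_dvd_iff_map Ψ hF hF₂ histr histr₂ hpre hpre' hφ hχ).mp h.dvd)
      ((div_dvd_iff_map Ψ hF hF₂ histr histr₂ hpre hpre' hχ hφ).mp h.symm.dvd)
  · intro h
    exact dvd_antisymm_of_isSharp (hM _)
      ((div_dvd_iff_map Ψ hF hF₂ histr histr₂ hpre hpre' hφ hχ).mpr h.dvd)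
      ((div_dvd_iff_map Ψ hF hF₂ histr histr₂ hpre hpre' hχ hφ).mpr h.symm.dvd)

end PreFrobenioid

end Literature.AlgebraicGeometry.Frobenioids
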